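import Summits.FinalStateConjecture.FinalStateConjecture.Theorems.ClusterCompletenessAdiabaticMultiKerrILEDHardyCurrent

/-!
# Crux `AdiabaticMultiKerrILED` (line `Sketch`) — divergence of a spatial radial vector field

Helper file for the crux `stmt-FinalStateConjecture-14310`
(`Summit.FinalStateConjecture.FinalStateConjecture.Theses.ClusterCompleteness.AdiabaticMultiKerrILED`),
line `Sketch`, stub `sum_fderiv_radialField` (lead c7, wave 7).

On `E4 = ℝ⁴` (index `0` = time, indices `i.succ` = space, `‖x⃗‖ = E4.spatialNorm x`) the purely
spatial radial vector field `V⁰ = 0`, `Vⁱ = h xⁱ/‖x⃗‖` has the pointwise coordinate divergence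

`∑_μ ∂_μ V^μ = (x⃗·∇h)/‖x⃗‖ + 2h/‖x⃗‖`

at every point off the time axis at which `h` is differentiable (`sum_fderiv_radialField`):
`∂ᵢ (h xⁱ/s) = (∂ᵢ h) xⁱ/s + h ∂ᵢ (xⁱ/s)` and `∑ᵢ ∂ᵢ (xⁱ/s) = −1/s + 3/s = 2/s` (`s = ‖x⃗‖`,
`∂ᵢ s = xⁱ/s`); the latter is the flat divergence `∑ᵢ ∂ᵢ (g(r) xⁱ) = g′ r + 3 g` of
`hardy_sum_fderiv_comp_radius_mul_coord` for the profile `g(s) = s⁻¹`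
(`Kerr.radius 0 = E4.spatialNorm`, `Kerr.radius_zero_left`). [folklore]
-/

noncomputable section

-- the doubled `FinalStateConjecture.FinalStateConjecture` path component trips dupNamespace
set_option linter.dupNamespace false

open scoped BigOperators
open Literature.Geometry.Lorentzian

namespace Summit.FinalStateConjecture.FinalStateConjecture.Theorems

/-- **Flat divergence of the unit radial field**: `∑ᵢ ∂ᵢ (xⁱ/r) = 2/r` at a point with
`r = r(x) = ‖x⃗‖ > 0` (the case `g(s) = s⁻¹`, `g′ r + 3 g(r) = −1/r + 3/r`, of
`hardy_sum_fderiv_comp_radius_mul_coord`). [folklore] -/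
theorem radialField_sum_fderiv_inv_radius_mul_coord {x : E4} {r : ℝ} (hr : Kerr.radius 0 x = r)
    (h0 : 0 < r) :
    ∑ i : Fin 3, fderiv ℝ (fun z ↦ (Kerr.radius 0 z)⁻¹ * z i.succ) x (E4.basisVector i.succ) =
      2 * r⁻¹ := by
  have h : ∑ i : Fin 3, fderiv ℝ (fun z ↦ (Kerr.radius 0 z)⁻¹ * z i.succ) x
      (E4.basisVector i.succ) = -(r ^ 2)⁻¹ * r + 3 * r⁻¹ :=
    hardy_sum_fderiv_comp_radius_mul_coord (g := fun s : ℝ ↦ s⁻¹) hr h0 (hasDerivAt_inv h0.ne')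
  have hr0 : r ≠ 0 := h0.ne'
  rw [h]
  field_simp
  ring

/-- **Space components of the divergence**: for `h` differentiable at `x` and `r = r(x) > 0`,
`∂ᵢ (h xⁱ/‖x⃗‖) = h ∂ᵢ (xⁱ/r) + r⁻¹ xⁱ ∂ᵢ h` (Leibniz rule; `‖z⃗‖ = Kerr.radius 0 z`). [folklore] -/
theorem radialField_fderiv_mul_coord_div_spatialNorm {h : E4 → ℝ} {x : E4} {r : ℝ}
    (hr : Kerr.radius 0 x = r) (h0 : 0 < r) (hh : DifferentiableAt ℝ h x) (i : Fin 3) :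
    fderiv ℝ (fun z : E4 ↦ h z * z i.succ / E4.spatialNorm z) x (E4.basisVector i.succ) =
      h x * fderiv ℝ (fun z : E4 ↦ (Kerr.radius 0 z)⁻¹ * z i.succ) x (E4.basisVector i.succ) +
        r⁻¹ * x i.succ * fderiv ℝ h x (E4.basisVector i.succ) := by
  have hGd : DifferentiableAt ℝ (fun z : E4 ↦ (Kerr.radius 0 z)⁻¹ * z i.succ) x :=
    (hardy_hasFDerivAt_comp_radius (g := fun s : ℝ ↦ s⁻¹) hr h0
      (hasDerivAt_inv h0.ne')).differentiableAt.fun_mul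
        (KerrSchild.hasFDerivAt_coord i.succ x).differentiableAt
  have hfun : (fun z : E4 ↦ h z * z i.succ / E4.spatialNorm z) =
      fun z ↦ h z * ((Kerr.radius 0 z)⁻¹ * z i.succ) := by
    funext z
    rw [Kerr.radius_zero_left]
    ring
  rw [hfun, fderiv_fun_mul hh hGd, add_apply, smul_apply, smul_apply, smul_eq_mul, smul_eq_mul, hr]

/-! ### The registered stub -/

/-- **Stub `sum_fderiv_radialField`** (crux `AdiabaticMultiKerrILED`, line `Sketch`). Pointwise
coordinate divergence of the purely spatial radial vector field `V = (0, h x⃗/‖x⃗‖)` on `E4`: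
`∑_μ ∂_μ V^μ = (x⃗·∇h)/‖x⃗‖ + 2h/‖x⃗‖` wherever `x⃗ ≠ 0` and `h` is differentiable
(`∂ᵢ(h xⁱ/s) = (∂ᵢh) xⁱ/s + h (1/s − xᵢ²/s³)`, summed over the three spatial directions; the
time component is the constant `0`). [folklore] -/
theorem sum_fderiv_radialField : ∀ (h : E4 → ℝ) (x : E4), 0 < E4.spatialNorm x → DifferentiableAt ℝ h x →
    ∑ μ, fderiv ℝ (fun z : E4 ↦ if μ = 0 then (0 : ℝ) else h z * z μ / E4.spatialNorm z) x (E4.basisVector μ) =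
      (∑ i : Fin 3, x i.succ * fderiv ℝ h x (E4.basisVector i.succ)) / E4.spatialNorm x + 2 * h x / E4.spatialNorm x := by
  intro h x hx hh
  obtain ⟨r, hr⟩ : ∃ r, Kerr.radius 0 x = r := ⟨_, rfl⟩
  have hxr : E4.spatialNorm x = r := by rw [← Kerr.radius_zero_left, hr]
  have h0 : 0 < r := hxr ▸ hx
  have hD := radialField_sum_fderiv_inv_radius_mul_coord hr h0
  rw [Fin.sum_univ_succ]
  simp only [Fin.succ_ne_zero, ↓reduceIte, fderiv_const_apply, zero_apply, zero_add]
  rw [Finset.sum_congr rfl fun i _ ↦ radialField_fderiv_mul_coord_div_spatialNorm hr h0 hh i, hxr]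
  simp only [Fin.sum_univ_three] at hD ⊢
  linear_combination h x * hD

end Summit.FinalStateConjecture.FinalStateConjecture.Theorems

end
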